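import Literature.NumberTheory.EllipticCurves.IsogenyModularEquation
import Literature.NumberTheory.EllipticCurves.SingularModuliIntegral
import Literature.NumberTheory.EllipticCurves.IsogenyQuotientCurveProofs
import Literature.NumberTheory.DiophantineGeometry.FaltingsHeightIsogenyFiniteProofs
import Literature.NumberTheory.DiophantineGeometry.JDenominatorIdealCountProofs
import Literature.NumberTheory.DiophantineGeometry.GenEllLCyclic
import Literature.NumberTheory.DiophantineGeometry.GenEllMellProofs
import Literature.NumberTheory.DiophantineGeometry.GenEllMellReduction
import HarnessLib

/-!
# [GenEll] Lemma 3.5 (Global Rank One Subgroups of `l`-Torsion), PROVED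

S. Mochizuki, *Arithmetic elliptic curves in general position*, Math. J. Okayama Univ. **52** (2010)
[cite: MochizukiGenEll2010], Lemma 3.5, p. 17 (kurims p. 17; journal p. 19), read on the page:

> **Lemma 3.5 (Global Rank One Subgroups of `l`-Torsion).** Let `ε ∈ ℝ_{>0}`; `l` a prime number;
> `H_F ⊆ E_F` a subgroup scheme such that `H_F ×_F Q̄` is isomorphic to the constant group scheme
> determined by `ℤ/l·ℤ`. […] Write `(E_H)_F = E_F/H_F`. […] Suppose further that `l` is prime to the
> local heights of `E` at all of its primes of [bad] multiplicative reduction […]. Then we have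
> `(1/(12(1+ε)))·l·deg_∞(E) ≤ ht^Falt(E) + 2 log(l) + C` for some constant `C ∈ ℝ` which [may
> depend on `ε` but] is independent of `E`, `F`, `H_F`, and `l`.
>
> *Proof.* […] at primes of multiplicative reduction, `E_H` may be identified with the elliptic
> curve "`E′`" of Lemma 3.2, (ii). In particular, it follows that `deg_∞(E_H) = l · deg_∞(E)`. […]
> we conclude that `ht^Falt(E_H) ≤ ht^Falt(E) + 2·log(l)`. Thus, Lemma 3.5 follows from
> Proposition 3.4.

This proof-only file DISCHARGES the tree's named fact `GenEll_lemma35` (`GenEllLCyclic.lean`):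
`GenEll_lemma35_holds : GenEll_lemma35`, through the slightly more general
`GenEll_lemma35_general` (no "`F` totally imaginary" hypothesis — the form consumed by
`GenEll_lemma37_of_lemma35_general` of `GenEllFullGaloisProofs.lean`). Every input is a THEOREM of
the tree; the three steps of the printed proof are rendered as follows.

* `E_H = E/H_F` exists over `F` with an `F`-isogeny `E → E_H` of degree `l`: the tree's quotient
  isogeny (`WeierstrassCurve.exists_isogeny_ker_eq_and_comp_eq_nsmul_holds`, Silverman *AEC*
  III.4.12, `IsogenyQuotientCurveProofs.lean`) applied to the `Γ_F`-stable subgroup of order `l`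
  (`EllPoint.exists_isogeny_of_admitsLCyclic`).
* `ht^Falt(E_H) ≤ ht^Falt(E) + ½ log l (≤ … + 2 log l)`: Faltings' isogeny inequality for the
  stable height (`WeierstrassCurve.stableFaltingsHeight_le_of_isogeny_holds`,
  `FaltingsHeightIsogenyFiniteProofs.lean`).
* `deg_∞(E_H) = l · deg_∞(E)`: NOT via the Tate curve (the paper's Lemma 3.2) but via the MODULAR
  EQUATION of level `l`: `Φ_l(j(E), j(E_H)) = 0 = Φ_l(j(E_H), j(E))`
  (`WeierstrassCurve.Isogeny.evalXY_intModularPolynomial_j_of_degree_eq_prime_numberField`, the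
  number-field version of the tree's `ℚ`-statement in `IsogenyModularEquation.lean`, same proof with
  an arbitrary embedding `F → ℂ`), and the tree's link lemma
  `valuation_eq_pow_of_evalXY_intModularPolynomial` (`SingularModuliIntegral.lean`: `Φ_l(x,y)=0`,
  `|x|_v > 1`, `|y|_v ≤ |x|_v ⇒ |x|_v = |y|_v^l`). Hence at a finite place `v` with `ord_v j(E) < 0`
  EITHER `ord_v j(E) = l·ord_v j(E_H)` OR `ord_v j(E_H) = l·ord_v j(E)`; the first is excluded when
  `l ∤ ord_v j(E) = −h_v` ("`l` prime to the local height" — exactly the paper's hypothesis, used in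
  the paper through Lemma 3.2 (i)), and where `ord_v j(E) ≥ 0` also `ord_v j(E_H) ≥ 0`. With
  `ord_v 𝔇_j = max(0, −ord_v j)` (`WeierstrassCurve.count_coeIdeal_jDenominatorIdeal`) this gives
  `𝔇_{j(E_H)} = 𝔇_{j(E)}^l` (`WeierstrassCurve.Isogeny.jDenominatorIdeal_eq_pow_of_degree_eq_prime`),
  i.e. `deg_∞(E_H) = l·deg_∞(E)` in the rendering `deg_∞ = [F:ℚ]⁻¹ log N(𝔇_j)` of `GenEllMell.lean`.
* Proposition 3.4 (`prop34Ineq_of_pos`, `GenEllMellProofs.lean`): `deg_∞ ≲ ht_∞ ≲ 12(1+ε) ht^Falt`.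

Semistability enters only through "`h_v > 0 ⇒ v` is not of good reduction ⇒ `v` is multiplicative"
(`GenEllMellReduction.lean`), converting the paper's hypothesis at the multiplicative primes into
`l ∤ ord_v j(E)` wherever `ord_v j(E) < 0`. "`F` totally imaginary" (§3, p. 16) is not used.

Proof-only file (theorems only). The declarations in `namespace WeierstrassCurve.Isogeny` are
deliberate dot-notation extensions of the tree's isogeny prelude (`Isogeny.lean`).
-/

noncomputable section

open scoped Classical nonZeroDivisors WithZero

open NumberField IsDedekindDomain

/-! ## The modular equation along an isogeny of prime degree over a number field -/

namespace WeierstrassCurve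

namespace Isogeny

open Literature.NumberTheory.EllipticCurves _root_.PeriodPair

variable {K : Type} [Field K] [NumberField K] {W W' : WeierstrassCurve K} [W.IsElliptic] [W'.IsElliptic]

/-- **The period lattices of an isogeny over a number field, at an embedding `σ : K → ℂ`.** For an
isogeny `φ : W → W'` of elliptic curves over the number field `K` and `σ : K → ℂ` there are period
pairs `M, Λ'` with `j(M) = σ(j(W))`, `j(Λ') = σ(j(W'))`, `M ⊆ Λ'` and `[Λ' : M] = deg φ` (Silverman,
*AEC*, Thm. VI.4.1(b): over `ℂ` the isogeny is `z ↦ αz : ℂ/Λ → ℂ/Λ'` with `[Λ' : αΛ] = deg φ`; the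
tree's `exists_multiplier_of_isShort`, stated for number fields, after the `u = 1` changes of
variables to short models). The `ℚ`-case is `exists_periodPair_j_eq_relIndex_eq_degree`
(`IsogenyModularEquation.lean`); same proof. (Dot-notation extension of the tree's `Isogeny`.)
[cite: SilvermanAEC2009, Thm. VI.4.1(b) (PDF pp. 152–154)] -/
theorem exists_periodPair_j_eq_relIndex_eq_degree_of_embedding (φ : Isogeny W W') (σ : K →+* ℂ) :
    ∃ M L' : PeriodPair, M.j = σ W.j ∧ L'.j = σ W'.j ∧ M.lattice ≤ L'.lattice ∧
      M.lattice.toAddSubgroup.relIndex L'.lattice.toAddSubgroup = φ.degree := by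
  classical
  haveI : Invertible (2 : K) := invertibleOfNonzero two_ne_zero
  haveI : Invertible (3 : K) := invertibleOfNonzero three_ne_zero
  set C : VariableChange K := ⟨1, -W.b₂ / 12, -W.a₁ / 2, W.a₁ * W.b₂ / 24 - W.a₃ / 2⟩ with hC
  set C' : VariableChange K := ⟨1, -W'.b₂ / 12, -W'.a₁ / 2, W'.a₁ * W'.b₂ / 24 - W'.a₃ / 2⟩
    with hC'
  obtain ⟨h₁, h₂, h₃⟩ := shortChange_a₁_a₂_a₃ W
  obtain ⟨h₁', h₂', h₃'⟩ := shortChange_a₁_a₂_a₃ W'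
  obtain ⟨ψ, hψ⟩ := exists_degree_eq_of_smul φ C C'
  obtain ⟨α₀, hα₀, -, han⟩ := exists_multiplier_of_isShort ψ h₁ h₂ h₃ h₁' h₂' h₃'
  obtain ⟨L, hL₂, hL₃⟩ := ((C • W).map σ).exists_periodPair_of_isElliptic'
  obtain ⟨L', hL₂', hL₃'⟩ := ((C' • W').map σ).exists_periodPair_of_isElliptic'
  obtain ⟨hσα, hle, hdeg⟩ := han σ L L' hL₂ hL₃ hL₂' hL₃'
  refine ⟨L.mulLeft (σ α₀) hσα, L', ?_, ?_, hle, hdeg.trans hψ⟩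
  · rw [j_mulLeft, j_eq_weierstrassCurve_j hL₂ hL₃, map_j, variableChange_j]
  · rw [j_eq_weierstrassCurve_j hL₂' hL₃', map_j, variableChange_j]

/-- **An isogeny of prime degree `ℓ` over a number field satisfies the modular equation of level
`ℓ`**: `Φ_ℓ(j(W), j(W')) = 0` and `Φ_ℓ(j(W'), j(W)) = 0` for `Φ_ℓ = intModularPolynomial ℓ ∈ ℤ[Y][X]`
(Cox, Thm. 11.18 with (11.14)–(11.15); Silverman *AEC* VI.4.1(b)). Proved in `ℂ` along any embedding
`σ : K → ℂ` (`exists_periodPair_j_eq_relIndex_eq_degree_of_embedding`,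
`PeriodPair.evalXY_intModularPolynomial_j_of_relIndex_eq_prime`) and pulled back along `σ`. The
`ℚ`-case is `evalXY_intModularPolynomial_j_of_degree_eq_prime`. (Dot-notation extension of the
tree's `Isogeny`.) [cite: Cox2013, §11.C Thm. 11.18 and §11.B (11.14)–(11.15)] -/
theorem evalXY_intModularPolynomial_j_of_degree_eq_prime_numberField {L : Type} [Field L]
    [NumberField L] {E E' : WeierstrassCurve L} [E.IsElliptic] [E'.IsElliptic] (φ : Isogeny E E')
    {ℓ : ℕ} [Fact ℓ.Prime] (hdeg : φ.degree = ℓ) :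
    evalXY (intModularPolynomial ℓ) E.j E'.j = 0 ∧ evalXY (intModularPolynomial ℓ) E'.j E.j = 0 := by
  obtain ⟨σ⟩ := (inferInstance : Nonempty (L →+* ℂ))
  obtain ⟨M, L', hjM, hjL', hle, hind⟩ :=
    φ.exists_periodPair_j_eq_relIndex_eq_degree_of_embedding σ
  rw [hdeg] at hind
  obtain ⟨h1, h2⟩ := PeriodPair.evalXY_intModularPolynomial_j_of_relIndex_eq_prime ℓ hle hind
  rw [hjM, hjL'] at h1 h2
  refine ⟨σ.injective ?_, σ.injective ?_⟩
  · rw [map_evalXY, map_zero]; exact h1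
  · rw [map_evalXY, map_zero]; exact h2

end Isogeny

end WeierstrassCurve

/-! ## Pole orders of `j` along a modular link of prime level -/

namespace Literature.NumberTheory.DiophantineGeometry

open Literature.NumberTheory.EllipticCurves

/-- **Dichotomy of pole orders along `Φ_p`.** For a `ℤᵐ⁰`-valued valuation `w` with `w(ℤ) ≤ 1`, if
`Φ_p(x, y) = 0 = Φ_p(y, x)` and `w(x) > 1`, then `w(x) = w(y)^p` or `w(y) = w(x)^p` (the link lemma
`valuation_eq_pow_of_evalXY_intModularPolynomial` in whichever order `w(x), w(y)` compare; in
`q`-language: the `j`-invariants `p`-isogenous to `j(q)` are `j(q^p)` and the `j(ζ q^{1/p})`).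
[cite: Cox2013, §11.C Thm. 11.18(iii)–(iv)] -/
theorem valuation_eq_pow_or_of_evalXY_intModularPolynomial (p : ℕ) [Fact p.Prime] {F : Type*}
    [Field F] (w : Valuation F ℤᵐ⁰) (hw : ∀ n : ℤ, w (n : F) ≤ 1) {x y : F}
    (hxy : evalXY (intModularPolynomial p) x y = 0) (hyx : evalXY (intModularPolynomial p) y x = 0)
    (hx : 1 < w x) : w x = w y ^ p ∨ w y = w x ^ p := by
  rcases le_total (w y) (w x) with h | h
  · exact Or.inl (valuation_eq_pow_of_evalXY_intModularPolynomial p w hw hxy hx h)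
  · exact Or.inr (valuation_eq_pow_of_evalXY_intModularPolynomial p w hw hyx (lt_of_lt_of_le hx h) h)

/-- **Integrality propagates along `Φ_p`.** With `w`, `Φ_p(x, y) = 0 = Φ_p(y, x)` as above, if
`w(x) ≤ 1` then `w(y) ≤ 1` (else the link lemma at `(y, x)` gives `w(y) = w(x)^p ≤ 1`): a curve
`p`-isogenous to one with `v`-integral `j` has `v`-integral `j`. [cite: Cox2013, §11.C Thm. 11.18(iii)–(iv)] -/
theorem valuation_le_one_of_evalXY_intModularPolynomial (p : ℕ) [Fact p.Prime] {F : Type*}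
    [Field F] (w : Valuation F ℤᵐ⁰) (hw : ∀ n : ℤ, w (n : F) ≤ 1) {x y : F}
    (hyx : evalXY (intModularPolynomial p) y x = 0) (hx : w x ≤ 1) : w y ≤ 1 := by
  by_contra hy
  push Not at hy
  have h := valuation_eq_pow_of_evalXY_intModularPolynomial p w hw hyx hy (hx.trans hy.le)
  have hle : w x ^ p ≤ 1 := pow_le_one₀ zero_le hx
  rw [← h] at hle
  exact absurd hy (not_lt.mpr hle)

/-- **The pole order is multiplied by `p` when `p` does not divide it.** With `w`,
`Φ_p(x, y) = 0 = Φ_p(y, x)` as above, if `w(x) > 1` and `p ∤ log w(x)` (i.e. `p ∤ ord(x)`), then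
`w(y) = w(x)^p`: the other branch `w(x) = w(y)^p` of the dichotomy would make `log w(x)` a multiple
of `p`. In [GenEll] Lemma 3.5 this is the step "`l` prime to the local height ⇒ `E_H = E/μ_l`
locally ⇒ `q_{E_H} = q_E^l`" (there via the Tate curve, Lemma 3.2).
[cite: MochizukiGenEll2010, Lem 3.5 p.17] -/
theorem valuation_eq_pow_of_evalXY_intModularPolynomial_of_not_dvd (p : ℕ) [Fact p.Prime]
    {F : Type*} [Field F] (w : Valuation F ℤᵐ⁰) (hw : ∀ n : ℤ, w (n : F) ≤ 1) {x y : F}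
    (hxy : evalXY (intModularPolynomial p) x y = 0) (hyx : evalXY (intModularPolynomial p) y x = 0)
    (hx : 1 < w x) (hndvd : ¬ ((p : ℤ) ∣ WithZero.log (w x))) : w y = w x ^ p := by
  rcases valuation_eq_pow_or_of_evalXY_intModularPolynomial p w hw hxy hyx hx with h | h
  · exfalso
    refine hndvd ⟨WithZero.log (w y), ?_⟩
    rw [h, WithZero.log_pow, nsmul_eq_mul]
  · exact h

end Literature.NumberTheory.DiophantineGeometry

/-! ## The denominator ideal of `j` along an isogeny of prime degree -/

namespace WeierstrassCurve

namespace Isogeny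

open Literature.NumberTheory.EllipticCurves Literature.NumberTheory.DiophantineGeometry

variable {K : Type} [Field K] [NumberField K] {W W' : WeierstrassCurve K} [W.IsElliptic] [W'.IsElliptic]

/-- **`𝔇_{j(E')} = 𝔇_{j(E)}^ℓ` along an `ℓ`-isogeny `E → E'` when `ℓ` is prime to the pole orders of
`j(E)`.** For an isogeny of prime degree `ℓ` over a number field `K` such that `ℓ ∤ ord_v j(E)` at
every finite place `v` with `ord_v j(E) < 0` (i.e. `ℓ` prime to every local height of `E`,
[GenEll] Def. 3.3), the denominator ideals of the `j`-invariants (`jDenominatorIdeal`,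
`FaltingsHeight.lean`) satisfy `𝔇_{E'} = 𝔇_E^ℓ`: prime by prime, `ord_v 𝔇 = max(0, −ord_v j)`
(`count_coeIdeal_jDenominatorIdeal`) and `ord_v j(E') = ℓ·ord_v j(E)` where `ord_v j(E) < 0`,
`ord_v j(E') ≥ 0` where `ord_v j(E) ≥ 0` (the modular equation and the link lemmas above). This is
"`deg_∞(E_H) = l · deg_∞(E)`" of the proof of [GenEll] Lemma 3.5. (Dot-notation extension of the
tree's `Isogeny`.) [cite: MochizukiGenEll2010, Lem 3.5 p.17] -/
theorem jDenominatorIdeal_eq_pow_of_degree_eq_prime (φ : Isogeny W W') {ℓ : ℕ} [Fact ℓ.Prime]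
    (hdeg : φ.degree = ℓ)
    (hcop : ∀ v : HeightOneSpectrum (𝓞 K), 1 < v.valuation K W.j →
      ¬ ((ℓ : ℤ) ∣ WithZero.log (v.valuation K W.j))) :
    W'.jDenominatorIdeal = W.jDenominatorIdeal ^ ℓ := by
  obtain ⟨hxy, hyx⟩ := φ.evalXY_intModularPolynomial_j_of_degree_eq_prime_numberField hdeg
  have hw : ∀ (v : HeightOneSpectrum (𝓞 K)) (n : ℤ), v.valuation K (n : K) ≤ 1 := by
    intro v n
    have h := v.valuation_le_one (K := K) (n : 𝓞 K)
    simpa using h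
  -- the count of `v` in both sides, as fractional ideals
  have hcount : ∀ v : HeightOneSpectrum (𝓞 K),
      FractionalIdeal.count K v (W'.jDenominatorIdeal : FractionalIdeal (𝓞 K)⁰ K) =
        FractionalIdeal.count K v
          ((W.jDenominatorIdeal ^ ℓ : Ideal (𝓞 K)) : FractionalIdeal (𝓞 K)⁰ K) := by
    intro v
    rw [FractionalIdeal.coeIdeal_pow, FractionalIdeal.count_pow, count_coeIdeal_jDenominatorIdeal,
      count_coeIdeal_jDenominatorIdeal]
    set c : ℤ := FractionalIdeal.count K v (FractionalIdeal.spanSingleton (𝓞 K)⁰ W.j) with hc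
    set c' : ℤ := FractionalIdeal.count K v (FractionalIdeal.spanSingleton (𝓞 K)⁰ W'.j) with hc'
    by_cases hj : 1 < v.valuation K W.j
    · -- a pole of `j(E)`: `ord_v j(E') = ℓ · ord_v j(E)`
      have hj0 : W.j ≠ 0 := by
        rintro h
        rw [h, map_zero] at hj
        exact not_lt.mpr zero_le_one hj
      have hpow := valuation_eq_pow_of_evalXY_intModularPolynomial_of_not_dvd ℓ (v.valuation K) (hw v)
        hxy hyx hj (hcop v hj)
      have hvj0 : v.valuation K W.j ≠ 0 := (lt_trans zero_lt_one hj).ne'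
      have hj'0 : W'.j ≠ 0 := by
        intro h
        rw [h, map_zero] at hpow
        exact pow_ne_zero ℓ hvj0 hpow.symm
      rw [valuation_eq_exp_neg_count v hj0, valuation_eq_exp_neg_count v hj'0, ← WithZero.exp_nsmul,
        WithZero.exp_inj, ← hc, ← hc', nsmul_eq_mul] at hpow
      have hclt : c < 0 := by
        rw [valuation_eq_exp_neg_count v hj0, ← hc, ← WithZero.exp_zero, WithZero.exp_lt_exp] at hj
        omega
      have hℓ : (0 : ℤ) ≤ ℓ := Int.natCast_nonneg ℓ
      rw [max_eq_right (by omega : (0 : ℤ) ≤ -c), max_eq_right (by nlinarith : (0 : ℤ) ≤ -c')]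
      linarith
    · -- `j(E)` integral at `v`: so is `j(E')`
      push Not at hj
      have hj' := valuation_le_one_of_evalXY_intModularPolynomial ℓ (v.valuation K) (hw v) hyx hj
      have h0 : 0 ≤ c := by
        by_cases hj0 : W.j = 0
        · rw [hc, hj0, FractionalIdeal.spanSingleton_zero, FractionalIdeal.count_zero]
        · rwa [hc, count_nonneg_iff_valuation_le_one v hj0]
      have h0' : 0 ≤ c' := by
        by_cases hj0 : W'.j = 0
        · rw [hc', hj0, FractionalIdeal.spanSingleton_zero, FractionalIdeal.count_zero]
        · rwa [hc', count_nonneg_iff_valuation_le_one v hj0]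
      rw [max_eq_left (by omega : -c' ≤ (0 : ℤ)), max_eq_left (by omega : -c ≤ (0 : ℤ)), mul_zero]
  -- hence equality of the fractional ideals, then of the ideals
  have hD'0 : (W'.jDenominatorIdeal : FractionalIdeal (𝓞 K)⁰ K) ≠ 0 :=
    FractionalIdeal.coeIdeal_ne_zero.mpr W'.jDenominatorIdeal_ne_bot
  have hDpow : W.jDenominatorIdeal ^ ℓ ≠ ⊥ := by
    rw [← Ideal.zero_eq_bot]
    exact pow_ne_zero ℓ (by rw [Ideal.zero_eq_bot]; exact W.jDenominatorIdeal_ne_bot)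
  have hD0 : ((W.jDenominatorIdeal ^ ℓ : Ideal (𝓞 K)) : FractionalIdeal (𝓞 K)⁰ K) ≠ 0 :=
    FractionalIdeal.coeIdeal_ne_zero.mpr hDpow
  have heq : (W'.jDenominatorIdeal : FractionalIdeal (𝓞 K)⁰ K) =
      ((W.jDenominatorIdeal ^ ℓ : Ideal (𝓞 K)) : FractionalIdeal (𝓞 K)⁰ K) :=
    le_antisymm (fractionalIdeal_le_of_forall_count_le hD'0 hD0 fun v => (hcount v).symm.le)
      (fractionalIdeal_le_of_forall_count_le hD0 hD'0 fun v => (hcount v).le)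
  exact FractionalIdeal.coeIdeal_inj.mp heq

end Isogeny

end WeierstrassCurve

/-! ## [GenEll] Lemma 3.5 -/

namespace Literature.NumberTheory.DiophantineGeometry.GenEll

open Literature.NumberTheory.EllipticCurves Literature.IUT.LogVolume

namespace EllPoint

/-- **The quotient `E_H = E/H_F` by an `l`-cyclic subgroup scheme** ([GenEll] Lemma 3.5: "Write
`(E_H)_F = E_F/H_F`. [Thus, `(E_H)_F` is isogenous to `E_F` …]"): if `E_F` admits an `l`-cyclic
subgroup scheme (`AdmitsLCyclic`: a `Γ_F`-stable subgroup of order `l` of `E[l](F̄)`), there are an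
elliptic curve `E'` over the SAME field `F` and an `F`-isogeny `E → E'` of degree `l` — the tree's
quotient isogeny `WeierstrassCurve.exists_isogeny_ker_eq_and_comp_eq_nsmul_holds` (Silverman *AEC*
III.4.12 with Rem. III.4.13.2, proved in `IsogenyQuotientCurveProofs.lean`).
[cite: MochizukiGenEll2010, Lem 3.5 p.17] -/
theorem exists_isogeny_of_admitsLCyclic (P : EllPoint) {l : ℕ} (hl : l.Prime)
    (hH : P.AdmitsLCyclic l) :
    ∃ (W' : WeierstrassCurve P.F) (_ : W'.IsElliptic) (g : WeierstrassCurve.Isogeny P.W W'),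
      g.degree = l := by
  obtain ⟨H, hstab, hcard⟩ := hH
  set S : AddSubgroup P.W.geomPoints := H.map (P.W.geomTorsion (l : ℤ)).subtype with hS
  have hcardS : Nat.card S = l := by
    rw [← hcard]
    exact (Nat.card_congr (H.equivMapOfInjective (P.W.geomTorsion (l : ℤ)).subtype
      (AddSubgroup.subtype_injective _)).toEquiv).symm
  have hfin : (S : Set P.W.geomPoints).Finite := by
    have : Finite S := Nat.finite_of_card_ne_zero (by rw [hcardS]; exact hl.ne_zero)
    exact Set.toFinite _
  have hstabS : ∀ (σ : Field.absoluteGaloisGroup P.F) (Q : P.W.geomPoints), Q ∈ S → σ • Q ∈ S := by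
    rintro σ Q ⟨x, hx, rfl⟩
    exact ⟨σ • x, hstab σ x hx, rfl⟩
  obtain ⟨W', hW', g, hker⟩ := WeierstrassCurve.exists_isogeny_ker_eq_of
    P.W.exists_isogeny_ker_eq_and_comp_eq_nsmul_holds S hfin hstabS
  refine ⟨W', hW', g, ?_⟩
  rw [WeierstrassCurve.Isogeny.degree, hker, hcardS]

/-- For a semistable presented curve, the hypothesis of [GenEll] Lemma 3.5 "`l` prime to the local
heights at all primes of multiplicative reduction" gives `l ∤ ord_v j(E)` at EVERY finite place with
`|j(E)|_v > 1` (such a place is not of good reduction, `localHeight_nonpos_of_hasGoodReductionAt`,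
hence of multiplicative reduction by semistability; and `h_v = log |j|_v`, `localHeight_eq_log`).
[cite: MochizukiGenEll2010, Lem 3.5 p.17] -/
theorem not_dvd_log_valuation_j_of_isSemistable (P : EllPoint) (hss : P.IsSemistable) {l : ℕ}
    (hcop : ∀ v : HeightOneSpectrum (𝓞 P.F), P.W.HasMultiplicativeReductionAt v →
      ¬ ((l : ℤ) ∣ P.localHeight v))
    (v : HeightOneSpectrum (𝓞 P.F)) (hv : 1 < v.valuation P.F P.W.j) :
    ¬ ((l : ℤ) ∣ WithZero.log (v.valuation P.F P.W.j)) := by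
  rw [← P.localHeight_eq_log v]
  refine hcop v ?_
  by_contra hm
  have h0 := P.localHeight_nonpos_of_hasGoodReductionAt v
    (P.hasGoodReductionAt_of_not_hasMultiplicativeReductionAt hss v hm)
  rw [P.localHeight_eq_log v] at h0
  have hj0 : v.valuation P.F P.W.j ≠ 0 := (lt_trans zero_lt_one hv).ne'
  have hpos : (0 : ℤ) < WithZero.log (v.valuation P.F P.W.j) := by
    rw [WithZero.lt_log_iff_exp_lt hj0, WithZero.exp_zero]
    exact hv
  omega

end EllPoint

/-- **[GenEll] Lemma 3.5 for semistable elliptic curves over ARBITRARY number fields** (no "`F`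
totally imaginary"; the form in which the proof of Lemma 3.7, p. 18, invokes it, and the hypothesis
of `GenEll_lemma37_of_lemma35_general`): for every `ε > 0` there is `C ∈ ℝ` such that for every
presented semistable `E_F`, every prime `l` prime to the local heights of `E` at its primes of
multiplicative reduction, if `E_F` admits an `l`-cyclic subgroup scheme then
`(1/(12(1+ε)))·l·deg_∞(E) ≤ ht^Falt(E) + 2 log(l) + C`. PROVED: with `E_H = E/H_F`
(`exists_isogeny_of_admitsLCyclic`), `deg_∞(E_H) = l·deg_∞(E)`
(`jDenominatorIdeal_eq_pow_of_degree_eq_prime`), `ht^Falt(E_H) ≤ ht^Falt(E) + ½ log l`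
(`stableFaltingsHeight_le_of_isogeny_holds`) and `deg_∞ ≤ 12(1+ε) ht^Falt + O_ε(1)`
(`prop34Ineq_of_pos`); the constant is `(C₁ + C₂)/(12(1+ε))` for the two constants of Prop. 3.4.
[cite: MochizukiGenEll2010, Lem 3.5 p.17] -/
theorem GenEll_lemma35_general :
    ∀ ε : ℝ, 0 < ε → ∃ C : ℝ, ∀ (P : EllPoint) (l : ℕ), l.Prime → P.IsSemistable →
      P.AdmitsLCyclic l →
      (∀ v : HeightOneSpectrum (𝓞 P.F), P.W.HasMultiplicativeReductionAt v →
        ¬ ((l : ℤ) ∣ P.localHeight v)) →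
      (12 * (1 + ε))⁻¹ * l * P.degInf ≤ P.htFalt + 2 * Real.log l + C := by
  intro ε hε
  obtain ⟨⟨C₁, hC₁⟩, ⟨C₂, hC₂⟩, -⟩ := prop34Ineq_of_pos hε
  refine ⟨(12 * (1 + ε))⁻¹ * (C₁ + C₂), fun P l hl hss hcyc hcop => ?_⟩
  haveI : Fact l.Prime := ⟨hl⟩
  obtain ⟨W', hW', g, hdeg⟩ := P.exists_isogeny_of_admitsLCyclic hl hcyc
  -- the quotient, presented over the same field
  set P' : EllPoint := @EllPoint.mk P.F _ _ W' hW' with hP'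
  -- (a) Faltings' isogeny inequality
  have hF : P'.htFalt ≤ P.htFalt + 1 / 2 * Real.log l := by
    have h := WeierstrassCurve.stableFaltingsHeight_le_of_isogeny_holds P.W W' g
    rw [hdeg] at h
    exact h
  -- (b) `deg_∞(E_H) = l · deg_∞(E)`
  have hD : P'.degInf = l * P.degInf := by
    have hideal := WeierstrassCurve.Isogeny.jDenominatorIdeal_eq_pow_of_degree_eq_prime g hdeg
      (P.not_dvd_log_valuation_j_of_isSemistable hss hcop)
    show (P'.degree : ℝ)⁻¹ * Real.log (Ideal.absNorm W'.jDenominatorIdeal) =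
      l * ((P.degree : ℝ)⁻¹ * Real.log (Ideal.absNorm P.W.jDenominatorIdeal))
    have hdd : P'.degree = P.degree := rfl
    rw [hdd, hideal, map_pow, Nat.cast_pow, Real.log_pow]
    ring
  -- (c) Prop. 3.4 at `E_H`
  have h1 : P'.degInf - P'.htInf ≤ C₁ := hC₁ P' (Set.mem_univ _)
  have h2 : P'.htInf - 12 * (1 + ε) * P'.htFalt ≤ C₂ := hC₂ P' (Set.mem_univ _)
  have hl1 : (1 : ℝ) ≤ l := by exact_mod_cast hl.one_lt.le
  have hlog : 0 ≤ Real.log l := Real.log_nonneg hl1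
  have h12 : 0 < 12 * (1 + ε) := by positivity
  have key : (l : ℝ) * P.degInf ≤ 12 * (1 + ε) * (P.htFalt + 1 / 2 * Real.log l) + (C₁ + C₂) := by
    have h3 : P'.degInf ≤ 12 * (1 + ε) * P'.htFalt + (C₁ + C₂) := by linarith
    rw [hD] at h3
    nlinarith [mul_le_mul_of_nonneg_left hF h12.le]
  calc (12 * (1 + ε))⁻¹ * l * P.degInf = (12 * (1 + ε))⁻¹ * (l * P.degInf) := by ring
    _ ≤ (12 * (1 + ε))⁻¹ * (12 * (1 + ε) * (P.htFalt + 1 / 2 * Real.log l) + (C₁ + C₂)) :=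
        mul_le_mul_of_nonneg_left key (inv_nonneg.mpr h12.le)
    _ = P.htFalt + 1 / 2 * Real.log l + (12 * (1 + ε))⁻¹ * (C₁ + C₂) := by
        rw [mul_add, ← mul_assoc, inv_mul_cancel₀ h12.ne', one_mul]
    _ ≤ P.htFalt + 2 * Real.log l + (12 * (1 + ε))⁻¹ * (C₁ + C₂) := by linarith

/-- **[GenEll] Lemma 3.5 (Global Rank One Subgroups of `l`-Torsion), DISCHARGED**: the tree's named
fact `GenEll_lemma35` (`GenEllLCyclic.lean`; standing hypotheses of §3: `F` totally imaginary, `E_F`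
semistable) holds — the special case "`F` totally imaginary" of `GenEll_lemma35_general`.
[cite: MochizukiGenEll2010, Lem 3.5 p.17] -/
theorem GenEll_lemma35_holds : GenEll_lemma35 := by
  intro ε hε
  obtain ⟨C, hC⟩ := GenEll_lemma35_general ε hε
  exact ⟨C, fun P l hl _ hss hcyc hcop => hC P l hl hss hcyc hcop⟩

end Literature.NumberTheory.DiophantineGeometry.GenEll

end
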